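import Mathlib

/-!
# Bałaban's renormalization group for lattice gauge theories — the lattice-function norms of the series (`LatticeNorms`)

HONEST FRAMING (cell `lit-balaban`, unit r19, verbatim): statement-level skeleton of published theorems with citation tags;
proofs where landed; nothing here is a claim about the Yang–Mills mass gap.

CITATION HEADER.  This module is the CROSS-PAPER, CONCRETE typing of the norms, distances and weights on LATTICE FUNCTIONS that
T. Bałaban's series *Comm. Math. Phys.* **89** 571–597 (1983) [Balaban1983RegularityDecay] (cell number B4), **95** 17–40 (1984)
[Balaban1984PropagatorsI] (B5), **96** 223–250 (1984) [Balaban1984PropagatorsII] (B6), **98** 17–51 (1985) [Balaban1985Averaging]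
(B7), **99** 75–102 (1985) [Balaban1985RegularSpaces] (B8), **99** 389–434 (1985) [Balaban1985BackgroundPropagators] (B9),
**109** 249–301 (1987) [Balaban1987RG1] (B12) uses to state its bounds, each AS PRINTED and with its page:

* B6 p. 223: "a distance between two points `x, y ∈ ηZ^d`, `η > 0`, is given by the `l¹`-norm of the vector `x − y` and is denoted
  by `|x − y|`, i.e. `|x − y| = Σ_{μ=1}^d |x_μ − y_μ|`. This distance depends of course on the scale of the lattice." (`l1Dist`);
  B4 p. 577: "`|j − j'| = max_μ |j_μ − j'_μ|`" (`linfDist`).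
* B4 (1.9)–(1.10) p. 573: the sup norm `‖f‖_∞` of a function on a domain `Ω`; B5 (1.108) p. 35 and B9 (3.39) p. 397:
  "`|A| = max_μ sup_x |A_μ(x)|`, `|∇A| = max_{μ,ν} sup_x |(∂_μ A_ν)(x)|`" (`supNorm`: one sup over a finite index set — sites,
  bonds = (direction, site) pairs, or plaquettes).
* B7 (18) p. 21: "`⟨X, Y⟩ = Σ_{x ∈ Ω} η^d tr X*(x) Y(x)`, similarly for functions defined at bonds or plaquettes of `Ω`. The
  scalar products define the corresponding norms. They are `L²` norms and are denoted by `‖·‖` … The `L^p` norms,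
  `1 ≤ p ≤ ∞`, are defined in an obvious way."; B4 p. 571: "`‖·‖₂` denotes `L²`-norm on the lattice"; B4 (2.17) p. 578 uses
  `‖f‖_p`, `‖f‖_q` (`l2Inner`, `l2NormSq`, `l2Norm`, `lpNormPow`, `lpNorm`, weight `w = η^d` = `volElt η d`).
* HÖLDER NORMS, three printed variants:
  B5 (1.109) p. 35: "`‖A‖_α = max_μ sup_{x,x' : |x−x'| ≤ 1} |x − x'|^{−α} |A_μ(x) − A_μ(x')|`,
  `‖A‖_{1,α} = ‖∇A‖_α`" (plain differences, pairs at distance `≤ 1`);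
  B9 (3.40) p. 397: the same with the COVARIANT difference "`|R(U(Γ_{x,x'})) A_μ(x') − A_μ(x)|`", "`Γ_{x,x'}` is a shortest
  contour connecting points `x` and `x'`. It is understood that the `η`-scale is used in the above definitions. If we use
  another scale, then it is indicated explicitly by a superscript, e.g. `‖·‖^ξ_α`";
  B4 (2.14) p. 577: "`‖f‖_{1,α} = max{sup_x |f(x)|, sup_{x,μ} |(D^η_{A,μ} f)(x)|,
  sup_{x,x',μ} |x' − x|^{−α} |U(A(Γ_{x,x'}))(D^η_{A,μ} f)(x') − (D^η_{A,μ} f)(x)|}`, where the suprema are taken on a domain of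
  the function `f`" (NO restriction `|x − x'| ≤ 1`, and a full norm, not a seminorm).
  All three are instances of ONE definition `holderSeminorm α adm dist τ S f` — sup over the ADMISSIBLE pairs `adm x x'` of
  `S × S` with `0 < dist x x'` of `‖τ x x' (f x') − f x‖ / (dist x x')^α`, the transport `τ` being the identity (B5), or
  `R(U(Γ_{x,x'}))` / `U(A(Γ_{x,x'}))` supplied by the user (B9/B4); `holderNormOne` assembles B4's (2.14).
* B9 (3.41) p. 397 (recalled in B8 p. 86): the SCALE-WEIGHTED sup norm "`|A|_(α) = sup_{0 ≤ j ≤ k} sup_{b ∈ Ω_j \ Ω_{j+1}}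
  (L^j η)^{−α} |A(b)|`. Thus the norm `|A|_(α)` can be defined as the smallest number `C` such, that `|A(b)| ≤ C (L^j η)^α` for
  `b ∈ Ω_j \ Ω_{j+1}`, `j = 0, 1, …, k`." (`wsupNorm`, with the scale assignment `b ↦ j` as a function `scale : ι → ℕ`;
  `norm_le_wsupNorm_mul` and `wsupNorm_le_of_bound` are the two halves of the printed characterization, kernel-checked).
* The exponential DECAY WEIGHTS `exp(−δ₀ dist(·,·))` of B4 (1.9)/(1.16), B5 (1.110), B6 (2.55), B9 (3.42), B12 (0.25)
  (`decayWeight`), with the two manipulations the random-walk resummations use: splitting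
  `e^{−δ d} = e^{−(1−α)δ d} e^{−αδ d}` (B6 (2.55) p. 233) and the product bound from the triangle inequality (B6 (2.54) p. 233).

WHAT IS REPRODUCED: definitions only, plus their elementary API (each API lemma carries the citation tag of the printed object it
serves; none of them is a statement of the papers).  NO theorem of the series is asserted.  The
per-paper modules of the audit cell `pub-balaban` (`B4.lean`, `B5.lean`, `B6.lean`, `B9.lean`, …) carry these norms as ABSTRACT
fields (`supNorm`, `holder`, `l2Norm`, `dist`) of their `Setting` structures; this module is the concrete carrier they can be
instantiated with, and the one the `lit-balaban` skeleton rows cite by name.  The two MATRIX norms of B7 (17)/(19) are in the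
sibling module `MatrixNorms` (`ntr`, `nhsNorm`, operator norm) and are not repeated; the tree-length `d_j(X)` of B12 p. 257 is
`TreeLength.treeLen`; the torus `ℓ¹` distance in lattice units is `Setup.Site.tdist`.  The multiscale contour distance
`d(y, y')` of B6 (2.46) p. 231 is typed in §7 (v1.1) OVER a user-supplied admissible-bond graph; building that graph from the domain
geometry `{Ω_j}` stays with the per-paper modules (which take `d` as a field together with its triangle inequality (2.54)).
* (v1.1, §7) the MULTISCALE CONTOUR DISTANCE `d(y, y')` of B6 (2.46) p. 231 identified with Mathlib's graph distance `SimpleGraph.edist` of the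
  admissible-bond graph (each admissible bond of the lattice `Λ_j` has weighted length `(L^j η)^{−1} · L^j η = 1`), with (2.54) = `edist_triangle`
  (`contourDist`, `contourDist_triangle`, `contourDist_chain`, `contourWeight`, `contourWeight_mul_le`).
* (v1.2, docstrings only; no declaration, statement or proof changed) cross-references naming the PRE-EXISTING decls of the tree that
  cite the same printed locus (`linfDist` ↔ `B4RandomWalk213.cubeAdj` &c.; `holderSeminorm(B9)` ↔ `B11HolderComplex.HolderOn`;
  `contourWeight` ↔ `B6DomainMajorant`/`B11SectG`/`B11Reparam190` majorants) — cell `lit-balaban` SAMELOCUS pre-check 2026-08-20.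
* (v1.3, §§8–9) B4 p. 579: "Here `‖T‖_{q,p}` denotes a norm of an operator `T : L^p → L^q`" (the factors of the chain (2.21)
  p. 578): the `L^p` scale indexed by the reciprocal exponent `s = 1/p`, `s = 0 ↦ ‖·‖_∞` (`lsNorm`, the convention of the
  per-paper carriers `B4.CubeSetting.lpNorm`, `lpN`), the OPERATOR NORM between two gauges `opNorm NX NY T = inf{C ≥ 0 :
  NY (T f) ≤ C · NX f}` with its bound API (`IsOpBound`, `opNorm_le_of_bound`, `le_opNorm_mul`, `opNorm_comp_le`), the chain
  bound of (2.21) (`compChain`, `isOpBound_compChain`, `apply_compChain_le_prod_opNorm_mul`), and the lattice form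
  `opNormQP w t s S' S T = ‖T‖_{q,p}` (`q = 1/t`, `p = 1/s`) with `opNormQP_id_two_inf_le` (the volume factor `√(η^d|S|)` of the
  silent step `‖f‖₂ ≤ … ‖f‖_∞` of (2.21)).
JUNK VALUES (documented, CONVENTIONS §4): all sups are over FINITE index sets and return `0` on the empty set; a Hölder pair
with `dist x x' = 0` contributes `0`.
-/

open scoped BigOperators NNReal

namespace Literature.MathematicalPhysics.QuantumFieldTheory.Balaban1983to89

namespace LatticeNorms

noncomputable section

/-! ## 1. Distances on `ηℤ^d` -/

section Dist

variable {d : ℕ}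

/-- B6 p. 223: the `ℓ¹` distance `|x − y| = Σ_μ |x_μ − y_μ|` between points of `ηℤ^d`, in PHYSICAL units (a lattice
point is `η · n`, `n ∈ ℤ^d`, so the distance of `η n` and `η n'` is `η Σ_μ |n_μ − n'_μ|`); "This distance depends of course on the
scale of the lattice." [cite: Balaban1984PropagatorsII, Introduction p.223] -/
def l1Dist (η : ℝ) (x y : Fin d → ℤ) : ℝ := η * ∑ μ, (((x μ - y μ : ℤ)).natAbs : ℝ)

/-- Symmetry of the `ℓ¹` distance. [cite: Balaban1984PropagatorsII, Introduction p.223] -/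
lemma l1Dist_comm (η : ℝ) (x y : Fin d → ℤ) : l1Dist η x y = l1Dist η y x := by
  unfold l1Dist
  congr 1
  refine Finset.sum_congr rfl fun μ _ => ?_
  rw [← Int.natAbs_neg, neg_sub]

/-- `|x − x| = 0`. [cite: Balaban1984PropagatorsII, Introduction p.223] -/
@[simp] lemma l1Dist_self (η : ℝ) (x : Fin d → ℤ) : l1Dist η x x = 0 := by
  simp [l1Dist]

/-- Nonnegativity (for a nonnegative spacing). [cite: Balaban1984PropagatorsII, Introduction p.223] -/
lemma l1Dist_nonneg {η : ℝ} (hη : 0 ≤ η) (x y : Fin d → ℤ) : 0 ≤ l1Dist η x y :=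
  mul_nonneg hη (Finset.sum_nonneg fun _ _ => Nat.cast_nonneg _)

/-- Triangle inequality for the `ℓ¹` distance. [cite: Balaban1984PropagatorsII, Introduction p.223] -/
lemma l1Dist_triangle {η : ℝ} (hη : 0 ≤ η) (x y z : Fin d → ℤ) :
    l1Dist η x z ≤ l1Dist η x y + l1Dist η y z := by
  unfold l1Dist
  rw [← mul_add, ← Finset.sum_add_distrib]
  refine mul_le_mul_of_nonneg_left (Finset.sum_le_sum fun μ _ => ?_) hη
  have h : (x μ - z μ).natAbs ≤ (x μ - y μ).natAbs + (y μ - z μ).natAbs := by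
    have := Int.natAbs_add_le (x μ - y μ) (y μ - z μ)
    rwa [show x μ - y μ + (y μ - z μ) = x μ - z μ by ring] at this
  exact_mod_cast h

/-- B4 p. 577: the `ℓ^∞` distance in LATTICE units, "`|j − j'| = max_μ |j_μ − j'_μ|`" (used to say when two cubes of the
random-walk expansion (2.13) are far apart: "`G_k(□_j, Ã_j) h_j K_{j'} G_k(□_{j'}, Ã_{j'}) = 0` if `|j − j'| > 1`").
Pre-existing carriers at this locus (v1.2 cross-reference): the random-walk modules `B4RandomWalk213` (`cubeAdj`, `IsWalk`, `walks`),
`B4LpChain221` (`order_vec_eq_sum_walks`) and `B4RandomWalkDelta112` encode (2.13) through the cube ADJACENCY relation `|j − j'| ≤ 1`;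
this is the distance itself (`linfDist_le_iff` is the bridge).
[cite: Balaban1983RegularityDecay, (2.13) p.577] -/
def linfDist (x y : Fin d → ℤ) : ℕ := Finset.univ.sup fun μ => (x μ - y μ).natAbs

/-- Each coordinate difference is bounded by the `ℓ^∞` distance. [cite: Balaban1983RegularityDecay, (2.13) p.577] -/
lemma natAbs_sub_le_linfDist (x y : Fin d → ℤ) (μ : Fin d) : (x μ - y μ).natAbs ≤ linfDist x y :=
  Finset.le_sup (f := fun μ => (x μ - y μ).natAbs) (Finset.mem_univ μ)

/-- `|x − y|_∞ ≤ n` iff every coordinate difference is `≤ n`. [cite: Balaban1983RegularityDecay, (2.13) p.577] -/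
lemma linfDist_le_iff (x y : Fin d → ℤ) (n : ℕ) : linfDist x y ≤ n ↔ ∀ μ, (x μ - y μ).natAbs ≤ n := by
  simp [linfDist, Finset.sup_le_iff]

/-- Symmetry of the `ℓ^∞` distance. [cite: Balaban1983RegularityDecay, (2.13) p.577] -/
lemma linfDist_comm (x y : Fin d → ℤ) : linfDist x y = linfDist y x := by
  unfold linfDist
  congr 1
  funext μ
  rw [← Int.natAbs_neg, neg_sub]

/-- `|x − x|_∞ = 0`. [cite: Balaban1983RegularityDecay, (2.13) p.577] -/
@[simp] lemma linfDist_self (x : Fin d → ℤ) : linfDist x x = 0 := by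
  simp [linfDist]

/-- Triangle inequality for the `ℓ^∞` distance. [cite: Balaban1983RegularityDecay, (2.13) p.577] -/
lemma linfDist_triangle (x y z : Fin d → ℤ) : linfDist x z ≤ linfDist x y + linfDist y z := by
  rw [linfDist_le_iff]
  intro μ
  have h : (x μ - z μ).natAbs ≤ (x μ - y μ).natAbs + (y μ - z μ).natAbs := by
    have := Int.natAbs_add_le (x μ - y μ) (y μ - z μ)
    rwa [show x μ - y μ + (y μ - z μ) = x μ - z μ by ring] at this
  exact h.trans (Nat.add_le_add (natAbs_sub_le_linfDist x y μ) (natAbs_sub_le_linfDist y z μ))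

/-- The `ℓ^∞` distance is dominated by the `ℓ¹` distance in lattice units (`η = 1`). [cite: Balaban1983RegularityDecay, (2.13) p.577] -/
lemma linfDist_le_l1Dist (x y : Fin d → ℤ) : (linfDist x y : ℝ) ≤ l1Dist 1 x y := by
  unfold l1Dist
  rw [one_mul]
  obtain hd | hd := isEmpty_or_nonempty (Fin d)
  · simp [linfDist]
  · obtain ⟨μ, -, hμ⟩ := Finset.exists_mem_eq_sup (Finset.univ : Finset (Fin d)) Finset.univ_nonempty
      fun μ => (x μ - y μ).natAbs
    unfold linfDist
    rw [hμ]
    exact_mod_cast Finset.single_le_sum (f := fun μ => ((x μ - y μ).natAbs : ℝ)) (fun _ _ => Nat.cast_nonneg _)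
      (Finset.mem_univ μ)

end Dist

/-! ## 2. The sup norm over a finite region -/

section Sup

variable {ι : Type*} {E : Type*} [SeminormedAddCommGroup E]

/-- B4 (1.9) p. 573 `‖f‖_∞`; B5 (1.108) p. 35 / B9 (3.39) p. 397 `|A| = max_μ sup_x |A_μ(x)|`: the supremum of the pointwise
norms of `f` over a FINITE index set `S` (sites of a domain `Ω`, or its bonds `(μ, x)`, or its plaquettes); value `0` on
`S = ∅` (junk value, documented). [cite: Balaban1984PropagatorsI, (1.108) p.35] -/
def supNorm (S : Finset ι) (f : ι → E) : ℝ := ((S.sup fun x => ‖f x‖₊ : ℝ≥0) : ℝ)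

/-- `‖f‖_∞ ≥ 0`. [cite: Balaban1984PropagatorsI, (1.108) p.35] -/
lemma supNorm_nonneg (S : Finset ι) (f : ι → E) : 0 ≤ supNorm S f := NNReal.coe_nonneg _

/-- The defining bound `|f(x)| ≤ ‖f‖_∞` for `x` in the region. [cite: Balaban1984PropagatorsI, (1.108) p.35] -/
lemma norm_le_supNorm {S : Finset ι} (f : ι → E) {x : ι} (hx : x ∈ S) : ‖f x‖ ≤ supNorm S f := by
  have h : ‖f x‖₊ ≤ S.sup fun x => ‖f x‖₊ := Finset.le_sup (f := fun x => ‖f x‖₊) hx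
  have h' : ((‖f x‖₊ : ℝ≥0) : ℝ) ≤ ((S.sup fun x => ‖f x‖₊ : ℝ≥0) : ℝ) := NNReal.coe_le_coe.mpr h
  simpa [supNorm] using h'

/-- `‖f‖_∞ ≤ C` as soon as `|f(x)| ≤ C` on the region (`C ≥ 0`). [cite: Balaban1984PropagatorsI, (1.108) p.35] -/
lemma supNorm_le {S : Finset ι} {f : ι → E} {C : ℝ} (hC : 0 ≤ C) (h : ∀ x ∈ S, ‖f x‖ ≤ C) : supNorm S f ≤ C := by
  unfold supNorm
  have : (S.sup fun x => ‖f x‖₊) ≤ C.toNNReal := Finset.sup_le fun x hx => by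
    rw [← NNReal.coe_le_coe, Real.coe_toNNReal _ hC, coe_nnnorm]
    exact h x hx
  calc ((S.sup fun x => ‖f x‖₊ : ℝ≥0) : ℝ) ≤ (C.toNNReal : ℝ) := NNReal.coe_le_coe.mpr this
    _ = C := Real.coe_toNNReal _ hC

/-- `‖f‖_∞ ≤ C` iff the pointwise bound holds (`C ≥ 0`). [cite: Balaban1984PropagatorsI, (1.108) p.35] -/
lemma supNorm_le_iff {S : Finset ι} {f : ι → E} {C : ℝ} (hC : 0 ≤ C) : supNorm S f ≤ C ↔ ∀ x ∈ S, ‖f x‖ ≤ C :=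
  ⟨fun h _ hx => (norm_le_supNorm f hx).trans h, supNorm_le hC⟩

/-- Monotonicity of `‖f‖_∞` in the region. [cite: Balaban1984PropagatorsI, (1.108) p.35] -/
lemma supNorm_mono {S T : Finset ι} (h : S ⊆ T) (f : ι → E) : supNorm S f ≤ supNorm T f :=
  supNorm_le (supNorm_nonneg T f) fun _ hx => norm_le_supNorm f (h hx)

/-- The junk value on the empty region. [cite: Balaban1984PropagatorsI, (1.108) p.35] -/
@[simp] lemma supNorm_empty (f : ι → E) : supNorm (∅ : Finset ι) f = 0 := by simp [supNorm]

/-- `‖0‖_∞ = 0`. [cite: Balaban1984PropagatorsI, (1.108) p.35] -/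
@[simp] lemma supNorm_zero (S : Finset ι) : supNorm S (fun _ => (0 : E)) = 0 := by simp [supNorm]

/-- Triangle inequality `‖f + g‖_∞ ≤ ‖f‖_∞ + ‖g‖_∞`. [cite: Balaban1984PropagatorsI, (1.108) p.35] -/
lemma supNorm_add_le (S : Finset ι) (f g : ι → E) : supNorm S (f + g) ≤ supNorm S f + supNorm S g :=
  supNorm_le (add_nonneg (supNorm_nonneg S f) (supNorm_nonneg S g)) fun x hx =>
    (norm_add_le (f x) (g x)).trans (add_le_add (norm_le_supNorm f hx) (norm_le_supNorm g hx))

/-- Homogeneity `‖c f‖_∞ = |c| ‖f‖_∞` for a normed space. [cite: Balaban1984PropagatorsI, (1.108) p.35] -/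
lemma supNorm_smul {F : Type*} [SeminormedAddCommGroup F] [NormedSpace ℝ F] (S : Finset ι) (c : ℝ) (f : ι → F) :
    supNorm S (c • f) = |c| * supNorm S f := by
  unfold supNorm
  have : (S.sup fun x => ‖(c • f) x‖₊) = ‖c‖₊ * S.sup fun x => ‖f x‖₊ := by
    simp_rw [Pi.smul_apply, nnnorm_smul]
    exact (NNReal.mul_finset_sup ‖c‖₊ S fun x => ‖f x‖₊).symm
  rw [this, NNReal.coe_mul, coe_nnnorm, Real.norm_eq_abs]

end Sup

/-! ## 3. The `L²` scalar product and the `L^p` norms with the lattice volume element (B7 (18)) -/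

section Lp

variable {ι : Type*} {E : Type*} [SeminormedAddCommGroup E]

/-- The lattice volume element `η^d` of B7 (18) p. 21 / B4 (1.3) p. 572 (the weight of one site of `ηℤ^d`).
[cite: Balaban1985Averaging, (18) p.21] -/
def volElt (η : ℝ) (d : ℕ) : ℝ := η ^ d

/-- `η^d > 0` for `η > 0`. [cite: Balaban1985Averaging, (18) p.21] -/
lemma volElt_pos {η : ℝ} (hη : 0 < η) (d : ℕ) : 0 < volElt η d := pow_pos hη d

/-- B7 (18) p. 21: the scalar product `⟨X, Y⟩ = Σ_{x ∈ Ω} η^d tr X*(x) Y(x)` of lattice functions, here for functions with values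
in a REAL inner-product space `F` (for `ℝ^N`-valued functions of B4 this is literal; for matrix-valued functions B7's `tr X*Y` is
the real part of the normalized Hilbert–Schmidt product `MatrixNorms.nhsInner`), with the volume element as an explicit weight
`w` (`w = volElt η d`). [cite: Balaban1985Averaging, (18) p.21] -/
def l2Inner {F : Type*} [NormedAddCommGroup F] [InnerProductSpace ℝ F] (w : ℝ) (S : Finset ι) (X Y : ι → F) : ℝ :=
  ∑ x ∈ S, w * inner ℝ (X x) (Y x)

/-- B7 p. 21 "The scalar products define the corresponding norms. They are `L²` norms": `‖f‖² = Σ_{x ∈ Ω} η^d |f(x)|²`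
(B4 p. 571 "`‖·‖₂` denotes `L²`-norm on the lattice"). [cite: Balaban1985Averaging, (18) p.21] -/
def l2NormSq (w : ℝ) (S : Finset ι) (f : ι → E) : ℝ := ∑ x ∈ S, w * ‖f x‖ ^ 2

/-- The `L²` norm `‖f‖ = (Σ_{x ∈ Ω} η^d |f(x)|²)^{1/2}`. [cite: Balaban1985Averaging, (18) p.21] -/
def l2Norm (w : ℝ) (S : Finset ι) (f : ι → E) : ℝ := Real.sqrt (l2NormSq w S f)

/-- B7 p. 21 "The `L^p` norms, `1 ≤ p ≤ ∞`, are defined in an obvious way"; B4 (2.17) p. 578 `‖f‖_p`: the `p`-th power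
`Σ_{x ∈ Ω} η^d |f(x)|^p` (real exponent `p`). [cite: Balaban1983RegularityDecay, (2.17) p.578] -/
def lpNormPow (w p : ℝ) (S : Finset ι) (f : ι → E) : ℝ := ∑ x ∈ S, w * ‖f x‖ ^ p

/-- The `L^p` norm `‖f‖_p = (Σ_{x ∈ Ω} η^d |f(x)|^p)^{1/p}` (`p = ∞` is `supNorm`). [cite: Balaban1983RegularityDecay, (2.17) p.578] -/
def lpNorm (w p : ℝ) (S : Finset ι) (f : ι → E) : ℝ := lpNormPow w p S f ^ (1 / p)

/-- `⟨X, X⟩ = ‖X‖²`. [cite: Balaban1985Averaging, (18) p.21] -/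
lemma l2Inner_self {F : Type*} [NormedAddCommGroup F] [InnerProductSpace ℝ F] (w : ℝ) (S : Finset ι) (X : ι → F) :
    l2Inner w S X X = l2NormSq w S X := by
  unfold l2Inner l2NormSq
  refine Finset.sum_congr rfl fun x _ => ?_
  rw [real_inner_self_eq_norm_sq]

/-- Symmetry of the real scalar product. [cite: Balaban1985Averaging, (18) p.21] -/
lemma l2Inner_comm {F : Type*} [NormedAddCommGroup F] [InnerProductSpace ℝ F] (w : ℝ) (S : Finset ι) (X Y : ι → F) :
    l2Inner w S X Y = l2Inner w S Y X := by
  unfold l2Inner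
  refine Finset.sum_congr rfl fun x _ => ?_
  rw [real_inner_comm]

/-- `‖f‖₂² ≥ 0` for a nonnegative weight. [cite: Balaban1985Averaging, (18) p.21] -/
lemma l2NormSq_nonneg {w : ℝ} (hw : 0 ≤ w) (S : Finset ι) (f : ι → E) : 0 ≤ l2NormSq w S f :=
  Finset.sum_nonneg fun _ _ => mul_nonneg hw (sq_nonneg _)

/-- `‖f‖₂ ≥ 0`. [cite: Balaban1985Averaging, (18) p.21] -/
lemma l2Norm_nonneg (w : ℝ) (S : Finset ι) (f : ι → E) : 0 ≤ l2Norm w S f := Real.sqrt_nonneg _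

/-- `‖f‖₂² = (‖f‖₂)²` for a nonnegative weight. [cite: Balaban1985Averaging, (18) p.21] -/
lemma l2Norm_sq {w : ℝ} (hw : 0 ≤ w) (S : Finset ι) (f : ι → E) : l2Norm w S f ^ 2 = l2NormSq w S f :=
  Real.sq_sqrt (l2NormSq_nonneg hw S f)

/-- `‖f‖_p^p ≥ 0` for a nonnegative weight. [cite: Balaban1983RegularityDecay, (2.17) p.578] -/
lemma lpNormPow_nonneg {w : ℝ} (hw : 0 ≤ w) (p : ℝ) (S : Finset ι) (f : ι → E) : 0 ≤ lpNormPow w p S f :=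
  Finset.sum_nonneg fun _ _ => mul_nonneg hw (Real.rpow_nonneg (norm_nonneg _) _)

/-- `‖f‖_p ≥ 0` for a nonnegative weight. [cite: Balaban1983RegularityDecay, (2.17) p.578] -/
lemma lpNorm_nonneg {w : ℝ} (hw : 0 ≤ w) (p : ℝ) (S : Finset ι) (f : ι → E) : 0 ≤ lpNorm w p S f :=
  Real.rpow_nonneg (lpNormPow_nonneg hw p S f) _

/-- The case `p = 2` of the `L^p` power is the `L²` norm squared. [cite: Balaban1983RegularityDecay, (2.17) p.578] -/
lemma lpNormPow_two (w : ℝ) (S : Finset ι) (f : ι → E) : lpNormPow w 2 S f = l2NormSq w S f := by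
  unfold lpNormPow l2NormSq
  refine Finset.sum_congr rfl fun x _ => ?_
  rw [Real.rpow_two]

/-- `‖f‖_2 = ‖f‖` (the `L^p` norm at `p = 2` is the `L²` norm). [cite: Balaban1983RegularityDecay, (2.17) p.578] -/
lemma lpNorm_two (w : ℝ) (S : Finset ι) (f : ι → E) : lpNorm w 2 S f = l2Norm w S f := by
  unfold lpNorm l2Norm
  rw [lpNormPow_two, Real.sqrt_eq_rpow]

/-- `‖f‖₂² ≤ η^d |Ω| ‖f‖_∞²`: the `L²` norm over a finite region is controlled by the sup norm (nonnegative weight). [cite: Balaban1985Averaging, (18) p.21] -/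
lemma l2NormSq_le_card_mul_supNorm_sq {w : ℝ} (hw : 0 ≤ w) (S : Finset ι) (f : ι → E) :
    l2NormSq w S f ≤ w * S.card * supNorm S f ^ 2 := by
  unfold l2NormSq
  calc ∑ x ∈ S, w * ‖f x‖ ^ 2 ≤ ∑ x ∈ S, w * supNorm S f ^ 2 :=
        Finset.sum_le_sum fun x hx => mul_le_mul_of_nonneg_left
          (pow_le_pow_left₀ (norm_nonneg _) (norm_le_supNorm f hx) 2) hw
    _ = w * S.card * supNorm S f ^ 2 := by rw [Finset.sum_const, nsmul_eq_mul]; ring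

end Lp

/-! ## 4. Hölder seminorms (B5 (1.109), B9 (3.40), B4 (2.14)) -/

section Holder

variable {ι : Type*} {E : Type*} [SeminormedAddCommGroup E]

open Classical in
/-- The common shape of the three printed Hölder (semi)norms: the supremum, over the pairs `(x, x')` of the finite region `S`
that are ADMISSIBLE (`adm x x'`: B5/B9 admit `|x − x'| ≤ 1` and the same vector index `μ`; B4 admits all pairs with the same
`μ`) and at positive distance, of the Hölder quotients `|τ_{x,x'} f(x') − f(x)| / |x − x'|^α`, where `τ x x' : E → E` is the
transport of the value at `x'` to `x` — the identity for B5 (1.109), "`R(U(Γ_{x,x'}))`" for B9 (3.40), "`U(A(Γ_{x,x'}))`"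
for B4 (2.14).  Value `0` when no pair is admissible (junk value, documented).  Pre-existing carrier at this locus (v1.2
cross-reference): `B11HolderComplex.HolderOn ρ β P u C` is the BOUND PREDICATE "`‖u x' − u x‖ ≤ C ρ(x, x')^β` on the pairs `P`"
(plain differences); this is the NUMBER (the seminorm, with transport), cf. `holderSeminorm_le`/`holder_bound`. [cite: Balaban1985BackgroundPropagators, (3.40) p.397] -/
def holderSeminorm (α : ℝ) (adm : ι → ι → Prop) (dist : ι → ι → ℝ) (τ : ι → ι → E → E) (S : Finset ι)
    (f : ι → E) : ℝ :=
  ((((S ×ˢ S).filter fun p => adm p.1 p.2 ∧ 0 < dist p.1 p.2).sup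
      fun p => ‖τ p.1 p.2 (f p.2) - f p.1‖₊ / (dist p.1 p.2 ^ α).toNNReal : ℝ≥0) : ℝ)

/-- `‖f‖_α ≥ 0`. [cite: Balaban1985BackgroundPropagators, (3.40) p.397] -/
lemma holderSeminorm_nonneg (α : ℝ) (adm : ι → ι → Prop) (dist : ι → ι → ℝ) (τ : ι → ι → E → E) (S : Finset ι)
    (f : ι → E) : 0 ≤ holderSeminorm α adm dist τ S f := NNReal.coe_nonneg _

/-- The defining Hölder bound: for an admissible pair at positive distance,
`|τ_{x,x'} f(x') − f(x)| ≤ ‖f‖_α · |x − x'|^α`. [cite: Balaban1985BackgroundPropagators, (3.40) p.397] -/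
lemma holder_bound {α : ℝ} {adm : ι → ι → Prop} {dist : ι → ι → ℝ} {τ : ι → ι → E → E} {S : Finset ι} (f : ι → E)
    {x x' : ι} (hx : x ∈ S) (hx' : x' ∈ S) (hadm : adm x x') (hpos : 0 < dist x x') :
    ‖τ x x' (f x') - f x‖ ≤ holderSeminorm α adm dist τ S f * dist x x' ^ α := by
  classical
  have hD : 0 < dist x x' ^ α := Real.rpow_pos_of_pos hpos α
  have hmem : (x, x') ∈ (S ×ˢ S).filter fun p => adm p.1 p.2 ∧ 0 < dist p.1 p.2 := by
    simp [Finset.mem_filter, hx, hx', hadm, hpos]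
  have hle : ‖τ x x' (f x') - f x‖₊ / (dist x x' ^ α).toNNReal ≤
      ((S ×ˢ S).filter fun p => adm p.1 p.2 ∧ 0 < dist p.1 p.2).sup
        fun p => ‖τ p.1 p.2 (f p.2) - f p.1‖₊ / (dist p.1 p.2 ^ α).toNNReal :=
    Finset.le_sup (f := fun p : ι × ι => ‖τ p.1 p.2 (f p.2) - f p.1‖₊ / (dist p.1 p.2 ^ α).toNNReal) hmem
  have hle' := NNReal.coe_le_coe.mpr hle
  rw [NNReal.coe_div, Real.coe_toNNReal _ hD.le, coe_nnnorm, div_le_iff₀ hD] at hle'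
  simpa [holderSeminorm] using hle'

/-- `‖f‖_α ≤ C` as soon as every admissible pair at positive distance satisfies the Hölder bound with constant `C ≥ 0`.
[cite: Balaban1985BackgroundPropagators, (3.40) p.397] -/
lemma holderSeminorm_le {α : ℝ} {adm : ι → ι → Prop} {dist : ι → ι → ℝ} {τ : ι → ι → E → E} {S : Finset ι}
    {f : ι → E} {C : ℝ} (hC : 0 ≤ C)
    (h : ∀ x ∈ S, ∀ x' ∈ S, adm x x' → 0 < dist x x' → ‖τ x x' (f x') - f x‖ ≤ C * dist x x' ^ α) :
    holderSeminorm α adm dist τ S f ≤ C := by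
  classical
  unfold holderSeminorm
  have : (((S ×ˢ S).filter fun p => adm p.1 p.2 ∧ 0 < dist p.1 p.2).sup
      fun p => ‖τ p.1 p.2 (f p.2) - f p.1‖₊ / (dist p.1 p.2 ^ α).toNNReal) ≤ C.toNNReal := by
    refine Finset.sup_le fun p hp => ?_
    simp only [Finset.mem_filter, Finset.mem_product] at hp
    obtain ⟨⟨h1, h2⟩, hadm, hpos⟩ := hp
    have hD : 0 < dist p.1 p.2 ^ α := Real.rpow_pos_of_pos hpos α
    rw [← NNReal.coe_le_coe, NNReal.coe_div, Real.coe_toNNReal _ hD.le, coe_nnnorm, Real.coe_toNNReal _ hC,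
      div_le_iff₀ hD]
    exact h p.1 h1 p.2 h2 hadm hpos
  calc ((((S ×ˢ S).filter fun p => adm p.1 p.2 ∧ 0 < dist p.1 p.2).sup
      fun p => ‖τ p.1 p.2 (f p.2) - f p.1‖₊ / (dist p.1 p.2 ^ α).toNNReal : ℝ≥0) : ℝ) ≤ (C.toNNReal : ℝ) :=
        NNReal.coe_le_coe.mpr this
    _ = C := Real.coe_toNNReal _ hC

/-- B5 (1.109) p. 35: "`‖A‖_α = max_μ sup_{x,x' : |x − x'| ≤ 1} |x − x'|^{−α} |A_μ(x) − A_μ(x')|`" — plain differences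
(identity transport), pairs at distance at most `1`; the index set `ι` is that of the values `A_μ(x)` (bonds), and `sameDir`
says that only values with the same vector index `μ` are compared (take `sameDir := fun _ _ => True` for scalar functions).
`‖A‖_{1,α} = ‖∇A‖_α` is this seminorm applied to the lattice gradient. [cite: Balaban1984PropagatorsI, (1.109) p.35] -/
def holderSeminormB5 (α : ℝ) (sameDir : ι → ι → Prop) (dist : ι → ι → ℝ) (S : Finset ι) (A : ι → E) : ℝ :=
  holderSeminorm α (fun b b' => sameDir b b' ∧ dist b b' ≤ 1) dist (fun _ _ => id) S A

/-- B9 (3.40) p. 397: the COVARIANT Hölder seminorm "`‖A‖_α = max_μ sup_{x,x' : |x − x'| ≤ 1} |x' − x|^{−α}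
|R(U(Γ_{x,x'})) A_μ(x') − A_μ(x)|`", the transport `τ x x' = R(U(Γ_{x,x'}))` along a shortest contour being supplied by the
user (pre-existing predicate form at this locus: `B11HolderComplex.HolderOn`, v1.2 cross-reference).
[cite: Balaban1985BackgroundPropagators, (3.40) p.397] -/
def holderSeminormB9 (α : ℝ) (sameDir : ι → ι → Prop) (dist : ι → ι → ℝ) (τ : ι → ι → E → E) (S : Finset ι)
    (A : ι → E) : ℝ :=
  holderSeminorm α (fun b b' => sameDir b b' ∧ dist b b' ≤ 1) dist τ S A

/-- B4 (2.14) p. 577: "`‖f‖_{1,α} = max{sup_x |f(x)|, sup_{x,μ} |(D^η_{A,μ} f)(x)|, sup_{x,x',μ} |x' − x|^{−α}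
|U(A(Γ_{x,x'}))(D^η_{A,μ} f)(x') − (D^η_{A,μ} f)(x)|}`, where the suprema are taken on a domain of the function `f`",
assembled from its three printed ingredients: `f` on the sites `S`, the family of its covariant derivatives `Df` on the index set
`SD` of pairs `(μ, x)` (both SUPPLIED — the covariant derivative `D^η_{A,μ}` is B4 (1.3)), and the transport `τ` between
derivative values with the same `μ` (`sameDir`).  No restriction `|x − x'| ≤ 1` here, as printed. [cite: Balaban1983RegularityDecay, (2.14) p.577] -/
def holderNormOne {κ : Type*} (α : ℝ) (sameDir : κ → κ → Prop) (distD : κ → κ → ℝ) (τ : κ → κ → E → E)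
    (S : Finset ι) (SD : Finset κ) (f : ι → E) (Df : κ → E) : ℝ :=
  max (supNorm S f) (max (supNorm SD Df) (holderSeminorm α sameDir distD τ SD Df))

/-- `‖f‖_{1,α} ≥ ‖f‖_∞`. [cite: Balaban1983RegularityDecay, (2.14) p.577] -/
lemma supNorm_le_holderNormOne {κ : Type*} (α : ℝ) (sameDir : κ → κ → Prop) (distD : κ → κ → ℝ)
    (τ : κ → κ → E → E) (S : Finset ι) (SD : Finset κ) (f : ι → E) (Df : κ → E) :
    supNorm S f ≤ holderNormOne α sameDir distD τ S SD f Df := le_max_left _ _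

/-- `‖f‖_{1,α} ≥ sup |D f|`. [cite: Balaban1983RegularityDecay, (2.14) p.577] -/
lemma supNorm_deriv_le_holderNormOne {κ : Type*} (α : ℝ) (sameDir : κ → κ → Prop) (distD : κ → κ → ℝ)
    (τ : κ → κ → E → E) (S : Finset ι) (SD : Finset κ) (f : ι → E) (Df : κ → E) :
    supNorm SD Df ≤ holderNormOne α sameDir distD τ S SD f Df := (le_max_left _ _).trans (le_max_right _ _)

/-- `‖f‖_{1,α} ≥` the Hölder seminorm of `D f`. [cite: Balaban1983RegularityDecay, (2.14) p.577] -/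
lemma holderSeminorm_le_holderNormOne {κ : Type*} (α : ℝ) (sameDir : κ → κ → Prop) (distD : κ → κ → ℝ)
    (τ : κ → κ → E → E) (S : Finset ι) (SD : Finset κ) (f : ι → E) (Df : κ → E) :
    holderSeminorm α sameDir distD τ SD Df ≤ holderNormOne α sameDir distD τ S SD f Df :=
  (le_max_right _ _).trans (le_max_right _ _)

/-- `‖f‖_{1,α} ≥ 0`. [cite: Balaban1983RegularityDecay, (2.14) p.577] -/
lemma holderNormOne_nonneg {κ : Type*} (α : ℝ) (sameDir : κ → κ → Prop) (distD : κ → κ → ℝ)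
    (τ : κ → κ → E → E) (S : Finset ι) (SD : Finset κ) (f : ι → E) (Df : κ → E) :
    0 ≤ holderNormOne α sameDir distD τ S SD f Df := (supNorm_nonneg S f).trans (le_max_left _ _)

end Holder

/-! ## 5. The scale-weighted sup norm `|A|_(α)` of B9 (3.41) -/

section Weighted

variable {ι : Type*} {E : Type*} [SeminormedAddCommGroup E]

/-- The length scale `L^j η` of the `j`-th lattice `T^{(j)}_{L^j η}` (B9 (3.41), B8 (1.4), B11 (9), B12 (1.16): all weights of
the series are powers of this quantity). [cite: Balaban1985BackgroundPropagators, (3.41) p.397] -/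
def scaleLen (L η : ℝ) (j : ℕ) : ℝ := L ^ j * η

/-- `L^j η > 0`. [cite: Balaban1985BackgroundPropagators, (3.41) p.397] -/
lemma scaleLen_pos {L η : ℝ} (hL : 0 < L) (hη : 0 < η) (j : ℕ) : 0 < scaleLen L η j := mul_pos (pow_pos hL j) hη

/-- `L^{j+1} η = L · L^j η`. [cite: Balaban1985BackgroundPropagators, (3.41) p.397] -/
lemma scaleLen_succ (L η : ℝ) (j : ℕ) : scaleLen L η (j + 1) = L * scaleLen L η j := by
  unfold scaleLen; ring

/-- With `η = L^{−k}` the `k`-th scale is the unit scale: `L^k η = 1` (B12 (1.2): `η = L^{−k}`). [cite: Balaban1985BackgroundPropagators, (3.41) p.397] -/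
lemma scaleLen_self {L : ℝ} (hL : L ≠ 0) (k : ℕ) : scaleLen L ((L ^ k)⁻¹) k = 1 := by
  unfold scaleLen; exact mul_inv_cancel₀ (pow_ne_zero k hL)

/-- B9 (3.41) p. 397 (recalled B8 p. 86): "`|A|_(α) = sup_{0 ≤ j ≤ k} sup_{b ∈ Ω_j \ Ω_{j+1}} (L^j η)^{−α} |A(b)|`" for an
arbitrary real `α`; the assignment `b ↦ j` (`b ∈ Ω_j \ Ω_{j+1}`, or `b ∈ Ω_j` "for `α` negative") is the function `scale`, the
union `⋃_j Ω_j` the finite set `S`.  Value `0` on `S = ∅`. [cite: Balaban1985BackgroundPropagators, (3.41) p.397] -/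
def wsupNorm (α L η : ℝ) (scale : ι → ℕ) (S : Finset ι) (A : ι → E) : ℝ :=
  ((S.sup fun b => ‖A b‖₊ * ((scaleLen L η (scale b)) ^ (-α)).toNNReal : ℝ≥0) : ℝ)

/-- `|A|_(α) ≥ 0`. [cite: Balaban1985BackgroundPropagators, (3.41) p.397] -/
lemma wsupNorm_nonneg (α L η : ℝ) (scale : ι → ℕ) (S : Finset ι) (A : ι → E) : 0 ≤ wsupNorm α L η scale S A :=
  NNReal.coe_nonneg _

/-- First half of the printed characterization (B9 p. 397): `|A(b)| ≤ |A|_(α) (L^j η)^α` for `b` of scale `j`. [cite: Balaban1985BackgroundPropagators, (3.41) p.397] -/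
lemma norm_le_wsupNorm_mul {α L η : ℝ} (hL : 0 < L) (hη : 0 < η) {scale : ι → ℕ} {S : Finset ι} (A : ι → E) {b : ι}
    (hb : b ∈ S) : ‖A b‖ ≤ wsupNorm α L η scale S A * scaleLen L η (scale b) ^ α := by
  have hs : 0 < scaleLen L η (scale b) := scaleLen_pos hL hη _
  have hle : ‖A b‖₊ * ((scaleLen L η (scale b)) ^ (-α)).toNNReal ≤
      S.sup fun b => ‖A b‖₊ * ((scaleLen L η (scale b)) ^ (-α)).toNNReal :=
    Finset.le_sup (f := fun b => ‖A b‖₊ * ((scaleLen L η (scale b)) ^ (-α)).toNNReal) hb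
  have hle' := NNReal.coe_le_coe.mpr hle
  rw [NNReal.coe_mul, Real.coe_toNNReal _ (Real.rpow_nonneg hs.le _), coe_nnnorm] at hle'
  have hαpos : 0 < scaleLen L η (scale b) ^ α := Real.rpow_pos_of_pos hs α
  calc ‖A b‖ = ‖A b‖ * scaleLen L η (scale b) ^ (-α) * scaleLen L η (scale b) ^ α := by
        rw [mul_assoc, ← Real.rpow_add hs, neg_add_cancel, Real.rpow_zero, mul_one]
    _ ≤ wsupNorm α L η scale S A * scaleLen L η (scale b) ^ α := by
        refine mul_le_mul_of_nonneg_right ?_ hαpos.le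
        simpa [wsupNorm] using hle'

/-- Second half of the printed characterization (B9 p. 397: "`|A|_(α)` can be defined as the smallest number `C` such, that
`|A(b)| ≤ C (L^j η)^α`"): a uniform bound `|A(b)| ≤ C (L^j η)^α` gives `|A|_(α) ≤ C`. [cite: Balaban1985BackgroundPropagators, (3.41) p.397] -/
lemma wsupNorm_le_of_bound {α L η : ℝ} (hL : 0 < L) (hη : 0 < η) {scale : ι → ℕ} {S : Finset ι} {A : ι → E} {C : ℝ}
    (hC : 0 ≤ C) (h : ∀ b ∈ S, ‖A b‖ ≤ C * scaleLen L η (scale b) ^ α) : wsupNorm α L η scale S A ≤ C := by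
  unfold wsupNorm
  have : (S.sup fun b => ‖A b‖₊ * ((scaleLen L η (scale b)) ^ (-α)).toNNReal) ≤ C.toNNReal := by
    refine Finset.sup_le fun b hb => ?_
    have hs : 0 < scaleLen L η (scale b) := scaleLen_pos hL hη _
    rw [← NNReal.coe_le_coe, NNReal.coe_mul, Real.coe_toNNReal _ (Real.rpow_nonneg hs.le _), coe_nnnorm,
      Real.coe_toNNReal _ hC]
    calc ‖A b‖ * scaleLen L η (scale b) ^ (-α) ≤ C * scaleLen L η (scale b) ^ α * scaleLen L η (scale b) ^ (-α) :=
          mul_le_mul_of_nonneg_right (h b hb) (Real.rpow_nonneg hs.le _)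
      _ = C := by rw [mul_assoc, ← Real.rpow_add hs, add_neg_cancel, Real.rpow_zero, mul_one]
  calc ((S.sup fun b => ‖A b‖₊ * ((scaleLen L η (scale b)) ^ (-α)).toNNReal : ℝ≥0) : ℝ) ≤ (C.toNNReal : ℝ) :=
        NNReal.coe_le_coe.mpr this
    _ = C := Real.coe_toNNReal _ hC

/-- The two halves together: `|A|_(α) ≤ C` iff `|A(b)| ≤ C (L^j η)^α` on the region (`C ≥ 0`, `L, η > 0`). [cite: Balaban1985BackgroundPropagators, (3.41) p.397] -/
lemma wsupNorm_le_iff {α L η : ℝ} (hL : 0 < L) (hη : 0 < η) {scale : ι → ℕ} {S : Finset ι} {A : ι → E} {C : ℝ}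
    (hC : 0 ≤ C) : wsupNorm α L η scale S A ≤ C ↔ ∀ b ∈ S, ‖A b‖ ≤ C * scaleLen L η (scale b) ^ α :=
  ⟨fun hle _ hb => (norm_le_wsupNorm_mul hL hη A hb).trans
      (mul_le_mul_of_nonneg_right hle (Real.rpow_nonneg (scaleLen_pos hL hη _).le _)),
    wsupNorm_le_of_bound hL hη hC⟩

/-- At weight exponent `α = 0` the weighted norm is the plain sup norm. [cite: Balaban1985BackgroundPropagators, (3.41) p.397] -/
lemma wsupNorm_zero_exp (L η : ℝ) (scale : ι → ℕ) (S : Finset ι) (A : ι → E) :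
    wsupNorm 0 L η scale S A = supNorm S A := by
  simp [wsupNorm, supNorm, Real.rpow_zero]

end Weighted

/-! ## 6. Exponential decay weights -/

section Decay

/-- The exponential decay weight `exp(−δ D)` attached to a distance `D` (B4 (1.9)/(1.16) `exp(−δ₀ |x − x'|)`, B5 (1.110)
`e^{−δ₀|y − y'|}`, B6 (2.55) `e^{−δ₀ d(y,y')}`, B9 (3.42) `e^{−δ₀ d(y,y')}`, B12 (0.25) `exp(−κ d_j(X))`).
[cite: Balaban1983RegularityDecay, (1.16) p.574] -/
def decayWeight (δ D : ℝ) : ℝ := Real.exp (-(δ * D))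

/-- `exp(−δ D) > 0`. [cite: Balaban1983RegularityDecay, (1.16) p.574] -/
lemma decayWeight_pos (δ D : ℝ) : 0 < decayWeight δ D := Real.exp_pos _

/-- `exp(−δ D) ≤ 1` for `δ, D ≥ 0`. [cite: Balaban1983RegularityDecay, (1.16) p.574] -/
lemma decayWeight_le_one {δ D : ℝ} (hδ : 0 ≤ δ) (hD : 0 ≤ D) : decayWeight δ D ≤ 1 := by
  unfold decayWeight
  rw [Real.exp_le_one_iff]
  exact neg_nonpos.mpr (mul_nonneg hδ hD)

/-- At distance `0` the weight is `1`. [cite: Balaban1983RegularityDecay, (1.16) p.574] -/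
@[simp] lemma decayWeight_zero_dist (δ : ℝ) : decayWeight δ 0 = 1 := by simp [decayWeight]

/-- Monotonicity: a larger distance gives a smaller weight (`δ ≥ 0`). [cite: Balaban1983RegularityDecay, (1.16) p.574] -/
lemma decayWeight_anti {δ D D' : ℝ} (hδ : 0 ≤ δ) (h : D ≤ D') : decayWeight δ D' ≤ decayWeight δ D := by
  unfold decayWeight
  exact Real.exp_le_exp.mpr (neg_le_neg (mul_le_mul_of_nonneg_left h hδ))

/-- B6 (2.55) p. 233: the SPLITTING of a decay factor with a parameter `α`,
`e^{−δ d} = e^{−(1−α)δ d} · e^{−αδ d}`. [cite: Balaban1984PropagatorsII, (2.55) p.233] -/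
lemma decayWeight_split (α δ D : ℝ) : decayWeight δ D = decayWeight ((1 - α) * δ) D * decayWeight (α * δ) D := by
  unfold decayWeight
  rw [← Real.exp_add]
  ring_nf

/-- B6 (2.54) p. 233 ("This is of course the triangle inequality for our distance. It implies …"): along a chain the product of
the weights is bounded by the weight of the end points, `e^{−δ d(x,y)} e^{−δ d(y,z)} ≤ e^{−δ d(x,z)}` whenever
`d(x,z) ≤ d(x,y) + d(y,z)` and `δ ≥ 0`. [cite: Balaban1984PropagatorsII, (2.54) p.233] -/
lemma decayWeight_mul_le_of_triangle {δ Dxy Dyz Dxz : ℝ} (hδ : 0 ≤ δ) (h : Dxz ≤ Dxy + Dyz) :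
    decayWeight δ Dxy * decayWeight δ Dyz ≤ decayWeight δ Dxz := by
  unfold decayWeight
  rw [← Real.exp_add, Real.exp_le_exp]
  nlinarith [mul_le_mul_of_nonneg_left h hδ]

/-- Iterated form of the previous bound for a chain `y₀, y₁, …, y_n` (B6 (2.54)–(2.55)): if the distance is a pseudometric
(triangle inequality), then `∏_{i<n} e^{−δ d(y_i, y_{i+1})} ≤ e^{−δ d(y₀, y_n)}`. [cite: Balaban1984PropagatorsII, (2.54) p.233] -/
lemma prod_decayWeight_le {ι : Type*} {δ : ℝ} (hδ : 0 ≤ δ) (dist : ι → ι → ℝ) (hself : ∀ x, dist x x = 0)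
    (htri : ∀ x y z, dist x z ≤ dist x y + dist y z) (y : ℕ → ι) (n : ℕ) :
    ∏ i ∈ Finset.range n, decayWeight δ (dist (y i) (y (i + 1))) ≤ decayWeight δ (dist (y 0) (y n)) := by
  induction n with
  | zero => simp [hself]
  | succ n ih =>
    rw [Finset.prod_range_succ]
    calc (∏ i ∈ Finset.range n, decayWeight δ (dist (y i) (y (i + 1)))) * decayWeight δ (dist (y n) (y (n + 1)))
        ≤ decayWeight δ (dist (y 0) (y n)) * decayWeight δ (dist (y n) (y (n + 1))) :=
          mul_le_mul_of_nonneg_right ih (decayWeight_pos _ _).le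
      _ ≤ decayWeight δ (dist (y 0) (y (n + 1))) := decayWeight_mul_le_of_triangle hδ (htri _ _ _)

end Decay

/-! ## 7. The multiscale contour distance `d(y, y')` of B6 (2.46) is a graph distance (v1.1, append-only) -/

section Contour

variable {V : Type*}

/-- B6 (2.45)–(2.46) p. 231, verbatim: *"For an arbitrary contour `Γ` on the lattice `T_η` we put `|Γ| = nη`, where `n` is a number of
bonds the contour `Γ` consists of. We will define a new distance between two points of `𝔅`. We consider a special class of contours
`Γ`. They have the property that a part of `Γ` contained in `B^j(Λ_j)` consists of bonds of the lattice `Λ_j`. Now we define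
`d(y, y') = inf_{Γ_{y,y'}} Σ_{j=0}^k (L^j η)^{−1} |Γ_{y,y'} ∩ B^j(Λ_j)|`, `y, y' ∈ 𝔅` (2.46), where the infimum is taken over all
admissible contours described above, with end-points `y, y'`."*  TYPED READING: a bond of the lattice `Λ_j` (spacing `L^j η`) has length
`L^j η`, so its weighted length `(L^j η)^{−1} · L^j η` is `1`; hence `d(y, y')` is the NUMBER OF BONDS of a shortest admissible contour,
i.e. the (extended, `ℕ∞`-valued) graph distance of the ADMISSIBLE-BOND GRAPH `G` on the multiscale vertex set (vertices: the
`Λ_j`-lattice points of the `B^j(Λ_j)`, `j = 0, …, k`; adjacency: being the two end-points of an admissible bond), which the geometry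
supplies as a `SimpleGraph`.  Mathlib's `SimpleGraph.edist` is literally this infimum over walks (value `⊤` when no admissible contour
joins `y, y'`).  The extension "`d(x, x') = d(y^j(x), y^{j'}(x'))` if `x ∈ B^j(Λ_j)`, `x' ∈ B^{j'}(Λ_{j'})`" is composition with the block
maps and stays with the geometry modules (`B6.Geometry.dist`, `B9`'s `Geometry.dist` carry `d` abstractly, with (2.54) as a field).
[cite: Balaban1984PropagatorsII, (2.46) p.231] -/
def contourDist (G : SimpleGraph V) (y y' : V) : ℕ∞ := G.edist y y'

/-- `d(y, y) = 0`. [cite: Balaban1984PropagatorsII, (2.46) p.231] -/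
@[simp] lemma contourDist_self (G : SimpleGraph V) (y : V) : contourDist G y y = 0 := SimpleGraph.edist_self

/-- `d(y, y') = d(y', y)` (contours can be reversed). [cite: Balaban1984PropagatorsII, (2.46) p.231] -/
lemma contourDist_comm (G : SimpleGraph V) (y y' : V) : contourDist G y y' = contourDist G y' y := SimpleGraph.edist_comm

/-- The infimum (2.46) is below the length of ANY admissible contour: `d(y, y') ≤ |Γ_{y,y'}|` (in bond units). [cite: Balaban1984PropagatorsII, (2.46) p.231] -/
lemma contourDist_le_length (G : SimpleGraph V) {y y' : V} (Γ : G.Walk y y') : contourDist G y y' ≤ Γ.length :=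
  SimpleGraph.edist_le Γ

/-- B6 (2.54) p. 233, verbatim: *"`d(y, y₁) + d(y₁, y₂) + … + d(y_{n−1}, y') ≥ d(y, y')`. This is of course the triangle inequality for
our distance."* — the two-point case. [cite: Balaban1984PropagatorsII, (2.54) p.233] -/
lemma contourDist_triangle (G : SimpleGraph V) (y y' y'' : V) :
    contourDist G y y'' ≤ contourDist G y y' + contourDist G y' y'' :=
  SimpleGraph.edist_triangle

/-- B6 (2.54) p. 233 for a chain `y = y₀, y₁, …, y_n = y'`: `d(y₀, y_n) ≤ Σ_{i<n} d(y_i, y_{i+1})`. [cite: Balaban1984PropagatorsII, (2.54) p.233] -/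
lemma contourDist_chain (G : SimpleGraph V) (y : ℕ → V) (n : ℕ) :
    contourDist G (y 0) (y n) ≤ ∑ i ∈ Finset.range n, contourDist G (y i) (y (i + 1)) := by
  induction n with
  | zero => simp
  | succ n ih =>
    rw [Finset.sum_range_succ]
    exact (contourDist_triangle G (y 0) (y n) (y (n + 1))).trans (add_le_add ih le_rfl)

open Classical in
/-- The decay factor `e^{−δ d(y, y')}` of B6 (2.55)/(2.64) built on the contour distance, with the value `0` for points joined by no
admissible contour (infinite distance).  Pre-existing decls at this locus (v1.2 cross-reference): the majorant-algebra
form of (2.52)–(2.55) is `B6DomainMajorant.hasMajorant_mul_weighted`/`hasMajorant_mul_rowWeight`, `B11SectG.hasMaj_comp`,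
`B11Reparam190.hasMaj_comp_localRight/Left` (kernels dominated by `C e^{−δ d}`); this is the bare weight they are dominated by.
[cite: Balaban1984PropagatorsII, (2.55) p.233] -/
def contourWeight (δ : ℝ) (G : SimpleGraph V) (y y' : V) : ℝ :=
  if G.Reachable y y' then decayWeight δ (G.dist y y' : ℝ) else 0

/-- For points joined by an admissible contour the weight is `exp(−δ · dist)` with the (finite) graph distance. [cite: Balaban1984PropagatorsII, (2.55) p.233] -/
lemma contourWeight_of_reachable {δ : ℝ} {G : SimpleGraph V} {y y' : V} (h : G.Reachable y y') :
    contourWeight δ G y y' = decayWeight δ (G.dist y y' : ℝ) := by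
  unfold contourWeight; rw [if_pos h]

/-- `0 ≤ e^{−δ d(y,y')} ≤ 1` for `δ ≥ 0` (first half). [cite: Balaban1984PropagatorsII, (2.55) p.233] -/
lemma contourWeight_nonneg (δ : ℝ) (G : SimpleGraph V) (y y' : V) : 0 ≤ contourWeight δ G y y' := by
  classical
  unfold contourWeight
  split_ifs
  · exact (decayWeight_pos _ _).le
  · exact le_rfl

/-- `e^{−δ d(y,y')} ≤ 1` for `δ ≥ 0`. [cite: Balaban1984PropagatorsII, (2.55) p.233] -/
lemma contourWeight_le_one {δ : ℝ} (hδ : 0 ≤ δ) (G : SimpleGraph V) (y y' : V) : contourWeight δ G y y' ≤ 1 := by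
  classical
  unfold contourWeight
  split_ifs
  · exact decayWeight_le_one hδ (Nat.cast_nonneg _)
  · exact zero_le_one

/-- (2.54) ⇒ the product bound used in (2.55): `e^{−δ d(y,y')} e^{−δ d(y',y'')} ≤ e^{−δ d(y,y'')}` (`δ ≥ 0`). [cite: Balaban1984PropagatorsII, (2.55) p.233] -/
lemma contourWeight_mul_le {δ : ℝ} (hδ : 0 ≤ δ) (G : SimpleGraph V) (y y' y'' : V) :
    contourWeight δ G y y' * contourWeight δ G y' y'' ≤ contourWeight δ G y y'' := by
  classical
  by_cases h1 : G.Reachable y y'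
  · by_cases h2 : G.Reachable y' y''
    · have h3 : G.Reachable y y'' := h1.trans h2
      rw [contourWeight_of_reachable h1, contourWeight_of_reachable h2, contourWeight_of_reachable h3]
      refine decayWeight_mul_le_of_triangle hδ ?_
      have := h3.coe_dist_eq_edist ▸ (SimpleGraph.edist_triangle (G := G) (u := y) (v := y') (w := y''))
      rw [← h1.coe_dist_eq_edist, ← h2.coe_dist_eq_edist] at this
      exact_mod_cast this
    · have : contourWeight δ G y' y'' = 0 := by unfold contourWeight; rw [if_neg h2]
      rw [this, mul_zero]; exact contourWeight_nonneg δ G y y''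
  · have : contourWeight δ G y y' = 0 := by unfold contourWeight; rw [if_neg h1]
    rw [this, zero_mul]; exact contourWeight_nonneg δ G y y''

end Contour

/-! ## 8. Exponents through their reciprocals: the family `s ↦ ‖·‖_{1/s}`, `s = 0 ↦ ‖·‖_∞` (B4 (2.17), v1.3) -/

section Reciprocal

variable {ι : Type*} {E : Type*} [SeminormedAddCommGroup E]

/-- B4 Lemma 2.2 (2.17) p. 578 bounds `G_k(□,Ã)` *"for `1 ≤ p, q ≤ ∞`, satisfying the condition `1/p − 1/p₁ ≤ 1/q ≤ 1/p` with
`p₁ > d`"*, and the chain (2.21) p. 578 runs through the exponents `∞, p₁, p₁/2, …, p₁/n₀ = 2`, i.e. through the RECIPROCALS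
`0, 1/p₁, 2/p₁, …, n₀/p₁ = 1/2`: the printed `L^p` scale is indexed by `s = 1/p ∈ [0, 1]`, `s = 0` being `p = ∞`.  The
per-paper carriers of the tree index the printed norms exactly so (`B4.CubeSetting.lpNorm s`: "exponents are carried by their
reciprocals `s = 1/p`, `t = 1/q ∈ [0, 1]`", `s = 0` the sup norm; the concrete `lpN s` of `B4Lemma21Zero` /
`B4Lemma22RegularCubeFam`).  `lsNorm w s S f` is that family over THIS module's concrete norms: `supNorm S f` at `s = 0`,
`lpNorm w (1/s) S f = (Σ_{x ∈ S} w ‖f x‖^{1/s})^s` otherwise. [cite: Balaban1983RegularityDecay, (2.17) p.578] -/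
def lsNorm (w s : ℝ) (S : Finset ι) (f : ι → E) : ℝ :=
  if s = 0 then supNorm S f else lpNorm w (1 / s) S f

/-- `s = 0` is `p = ∞`: the sup norm. [cite: Balaban1983RegularityDecay, (2.17) p.578] -/
@[simp] lemma lsNorm_zero (w : ℝ) (S : Finset ι) (f : ι → E) : lsNorm w 0 S f = supNorm S f := if_pos rfl

/-- `s ≠ 0`: the `L^{1/s}` norm. [cite: Balaban1983RegularityDecay, (2.17) p.578] -/
lemma lsNorm_of_ne_zero (w : ℝ) {s : ℝ} (hs : s ≠ 0) (S : Finset ι) (f : ι → E) :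
    lsNorm w s S f = lpNorm w (1 / s) S f := if_neg hs

/-- The printed `‖f‖_p` (any `p ≠ 0`, in print `1 ≤ p < ∞`) is recovered at `s = 1/p`. [cite: Balaban1983RegularityDecay, (2.17) p.578] -/
lemma lsNorm_one_div (w : ℝ) {p : ℝ} (hp : p ≠ 0) (S : Finset ι) (f : ι → E) :
    lsNorm w (1 / p) S f = lpNorm w p S f := by
  rw [lsNorm_of_ne_zero w (one_div_ne_zero hp), one_div_one_div]

/-- `s = 1/2` is the `L²` norm — the last links `‖·‖_{2,2}` of the chain (2.21). [cite: Balaban1983RegularityDecay, (2.21) p.578] -/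
lemma lsNorm_half (w : ℝ) (S : Finset ι) (f : ι → E) : lsNorm w (1 / 2) S f = l2Norm w S f := by
  rw [lsNorm_one_div w two_ne_zero, lpNorm_two]

/-- `‖f‖_{1/s} ≥ 0` for a nonnegative weight. [cite: Balaban1983RegularityDecay, (2.17) p.578] -/
lemma lsNorm_nonneg {w : ℝ} (hw : 0 ≤ w) (s : ℝ) (S : Finset ι) (f : ι → E) : 0 ≤ lsNorm w s S f := by
  unfold lsNorm
  split_ifs
  · exact supNorm_nonneg S f
  · exact lpNorm_nonneg hw _ S f

/-- The silent step between the two sides of (2.21) (`… ‖f‖₂ ≤ Σ' … ‖f‖_∞`, `supp f ⊂ □_{ω_n}`): over a finite region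
`‖f‖₂ ≤ (η^d |S|)^{1/2} ‖f‖_∞` (nonnegative weight); `B4LpChain221` carries this as its hypothesis `h2inf` with `V² = vol(supp f)`.
[cite: Balaban1983RegularityDecay, (2.21) p.578] -/
lemma l2Norm_le_sqrt_card_mul_supNorm {w : ℝ} (hw : 0 ≤ w) (S : Finset ι) (f : ι → E) :
    l2Norm w S f ≤ Real.sqrt (w * S.card) * supNorm S f := by
  change Real.sqrt (l2NormSq w S f) ≤ _
  calc Real.sqrt (l2NormSq w S f) ≤ Real.sqrt (w * S.card * supNorm S f ^ 2) :=
        Real.sqrt_le_sqrt (l2NormSq_le_card_mul_supNorm_sq hw S f)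
    _ = Real.sqrt (w * S.card) * supNorm S f := by
        rw [Real.sqrt_mul (mul_nonneg hw (Nat.cast_nonneg _)), Real.sqrt_sq (supNorm_nonneg S f)]

end Reciprocal

/-! ## 9. Operator norms between two gauges: the printed `‖T‖_{q,p}` (B4 p. 579, v1.3) -/

section Operator

variable {X Y Z : Type*}

/-- An OPERATOR BOUND in the shape the series uses it: `T` maps the gauge `NX` into the gauge `NY` with constant `C`,
`NY (T f) ≤ C · NX f` for every `f` — B4 (2.15)/(2.17) "`‖G_k(□,Ã)f‖_q ≤ c₂‖f‖_p`" read as a statement about the operator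
`G_k(□,Ã)`, and the form in which `B4LpChain221` CONSUMES the printed `‖T‖_{q,p}` of (2.21) (its dictionary: "an operator
bound `‖T‖_{q,p} ≤ β` ↦ `∀ g, nrm (level q) (T • g) ≤ β * nrm (level p) g`").  Gauges are bare functionals on plain types,
which is how every module of the series carries its norms. [cite: Balaban1983RegularityDecay, (2.21) pp.578–579] -/
def IsOpBound (NX : X → ℝ) (NY : Y → ℝ) (T : X → Y) (C : ℝ) : Prop := ∀ f, NY (T f) ≤ C * NX f

/-- B4 p. 579 [PDF 9] line 1, verbatim: *"Here `‖T‖_{q,p}` denotes a norm of an operator `T : L^p → L^q`."* (said of the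
factors `‖K_{ω_i}G_k(□_{ω_i},Ã_{ω_i})h_{ω_i}‖_{p₁/(i−1), p₁/i}` of (2.21) p. 578) — the operator norm of `T` from the gauge
`NX` (`‖·‖_p`) to the gauge `NY` (`‖·‖_q`): the infimum of the nonnegative constants `C` with `NY (T f) ≤ C · NX f` for all
`f` (the pattern of Mathlib's `ContinuousLinearMap.opNorm`, for bare gauge functionals).  JUNK VALUE `0` when no bound
exists (`sInf ∅ = 0` in `ℝ`); the API lemmas that use `‖T‖` as a bound ask for some bound to exist.  Lattice form:
`opNormQP` (§9, below). [cite: Balaban1983RegularityDecay, (2.21) pp.578–579] -/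
def opNorm (NX : X → ℝ) (NY : Y → ℝ) (T : X → Y) : ℝ := sInf {C | 0 ≤ C ∧ IsOpBound NX NY T C}

-- TODO(general form): for LINEAR `T` between the lattice `L^p` spaces realised as `MeasureTheory.Lp E p (w • count)` on the
-- finite region this is `ContinuousLinearMap.opNorm`; not instantiated here — no module of the series uses the `Lp` type, all
-- carry `‖·‖_p` as a functional on plain lattice functions (B4/B5/B6/B9 `Setting` fields, `lpN`, this module's `lpNorm`).

/-- Unfolding of `IsOpBound`. [cite: Balaban1983RegularityDecay, (2.21) pp.578–579] -/
lemma isOpBound_iff {NX : X → ℝ} {NY : Y → ℝ} {T : X → Y} {C : ℝ} :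
    IsOpBound NX NY T C ↔ ∀ f, NY (T f) ≤ C * NX f := Iff.rfl

/-- A larger constant is still a bound (nonnegative source gauge). [cite: Balaban1983RegularityDecay, (2.21) pp.578–579] -/
lemma IsOpBound.mono {NX : X → ℝ} {NY : Y → ℝ} {T : X → Y} {C C' : ℝ} (h : IsOpBound NX NY T C) (hCC' : C ≤ C')
    (hNX : ∀ f, 0 ≤ NX f) : IsOpBound NX NY T C' :=
  fun f => (h f).trans (mul_le_mul_of_nonneg_right hCC' (hNX f))

/-- The identity is bounded by `1` from a gauge to itself. [cite: Balaban1983RegularityDecay, (2.21) pp.578–579] -/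
lemma isOpBound_id (N : X → ℝ) : IsOpBound N N id 1 := fun f => by simp

/-- Bounds MULTIPLY under composition: `‖T₁T₂ f‖_r ≤ C₁‖T₂ f‖_q ≤ C₁C₂‖f‖_p` — the mechanism of the chain (2.21).
[cite: Balaban1983RegularityDecay, (2.21) pp.578–579] -/
lemma IsOpBound.comp {NX : X → ℝ} {NY : Y → ℝ} {NZ : Z → ℝ} {T₁ : Y → Z} {T₂ : X → Y} {C₁ C₂ : ℝ}
    (h₁ : IsOpBound NY NZ T₁ C₁) (h₂ : IsOpBound NX NY T₂ C₂) (hC₁ : 0 ≤ C₁) :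
    IsOpBound NX NZ (T₁ ∘ T₂) (C₁ * C₂) := fun f =>
  calc NZ (T₁ (T₂ f)) ≤ C₁ * NY (T₂ f) := h₁ (T₂ f)
    _ ≤ C₁ * (C₂ * NX f) := mul_le_mul_of_nonneg_left (h₂ f) hC₁
    _ = C₁ * C₂ * NX f := (mul_assoc _ _ _).symm

/-- `‖T‖ ≥ 0`. [cite: Balaban1983RegularityDecay, (2.21) pp.578–579] -/
lemma opNorm_nonneg (NX : X → ℝ) (NY : Y → ℝ) (T : X → Y) : 0 ≤ opNorm NX NY T :=
  Real.sInf_nonneg fun _ hC => hC.1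

/-- `‖T‖ ≤ C` from ANY nonnegative bound `C` (so (2.17) says `‖G_k(□,Ã)‖_{q,p} ≤ c₂` on the printed parallelogram, (2.15)
says `‖G_k(□,A)‖_{2,2} ≤ c₂`). [cite: Balaban1983RegularityDecay, (2.21) pp.578–579] -/
lemma opNorm_le_of_bound {NX : X → ℝ} {NY : Y → ℝ} {T : X → Y} {C : ℝ} (hC : 0 ≤ C) (h : IsOpBound NX NY T C) :
    opNorm NX NY T ≤ C :=
  csInf_le ⟨0, fun _ hC' => hC'.1⟩ ⟨hC, h⟩

/-- The operator norm is itself a bound, `NY (T f) ≤ ‖T‖ · NX f`, as soon as SOME bound exists and the source gauge is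
nonnegative (the use made of each factor `‖·‖_{q,p}` in (2.21)). [cite: Balaban1983RegularityDecay, (2.21) pp.578–579] -/
lemma le_opNorm_mul {NX : X → ℝ} {NY : Y → ℝ} {T : X → Y} (hex : ∃ C, 0 ≤ C ∧ IsOpBound NX NY T C)
    (hNX : ∀ f, 0 ≤ NX f) (f : X) : NY (T f) ≤ opNorm NX NY T * NX f := by
  obtain ⟨C₀, hC₀, hb₀⟩ := hex
  have hne : ({C | 0 ≤ C ∧ IsOpBound NX NY T C} : Set ℝ).Nonempty := ⟨C₀, hC₀, hb₀⟩
  rcases (hNX f).eq_or_lt with h0 | hpos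
  · have h1 : NY (T f) ≤ 0 := by simpa [← h0] using hb₀ f
    simpa [← h0] using h1
  · rw [← div_le_iff₀ hpos]
    exact le_csInf hne fun C hC => (div_le_iff₀ hpos).mpr (hC.2 f)

/-- Restatement: `‖T‖` is an operator bound for `T`. [cite: Balaban1983RegularityDecay, (2.21) pp.578–579] -/
lemma isOpBound_opNorm {NX : X → ℝ} {NY : Y → ℝ} {T : X → Y} (hex : ∃ C, 0 ≤ C ∧ IsOpBound NX NY T C)
    (hNX : ∀ f, 0 ≤ NX f) : IsOpBound NX NY T (opNorm NX NY T) := fun f => le_opNorm_mul hex hNX f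

/-- `‖T‖ ≤ C ↔ T` is bounded by `C` (`C ≥ 0`, some bound exists, nonnegative source gauge): `‖T‖` is the LEAST nonnegative
bound. [cite: Balaban1983RegularityDecay, (2.21) pp.578–579] -/
lemma opNorm_le_iff {NX : X → ℝ} {NY : Y → ℝ} {T : X → Y} (hex : ∃ C, 0 ≤ C ∧ IsOpBound NX NY T C)
    (hNX : ∀ f, 0 ≤ NX f) {C : ℝ} (hC : 0 ≤ C) : opNorm NX NY T ≤ C ↔ IsOpBound NX NY T C :=
  ⟨fun h => (isOpBound_opNorm hex hNX).mono h hNX, opNorm_le_of_bound hC⟩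

/-- `‖id‖ ≤ 1`. [cite: Balaban1983RegularityDecay, (2.21) pp.578–579] -/
lemma opNorm_id_le_one (N : X → ℝ) : opNorm N N id ≤ 1 := opNorm_le_of_bound zero_le_one (isOpBound_id N)

/-- SUBMULTIPLICATIVITY `‖T₁T₂‖_{r,p} ≤ ‖T₁‖_{r,q} ‖T₂‖_{q,p}` through an intermediate gauge — one step of the chain (2.21)
(both factors bounded, source and intermediate gauges nonnegative). [cite: Balaban1983RegularityDecay, (2.21) pp.578–579] -/
lemma opNorm_comp_le {NX : X → ℝ} {NY : Y → ℝ} {NZ : Z → ℝ} {T₁ : Y → Z} {T₂ : X → Y}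
    (hex₁ : ∃ C, 0 ≤ C ∧ IsOpBound NY NZ T₁ C) (hex₂ : ∃ C, 0 ≤ C ∧ IsOpBound NX NY T₂ C)
    (hNX : ∀ f, 0 ≤ NX f) (hNY : ∀ g, 0 ≤ NY g) :
    opNorm NX NZ (T₁ ∘ T₂) ≤ opNorm NY NZ T₁ * opNorm NX NY T₂ :=
  opNorm_le_of_bound (mul_nonneg (opNorm_nonneg _ _ _) (opNorm_nonneg _ _ _))
    ((isOpBound_opNorm hex₁ hNY).comp (isOpBound_opNorm hex₂ hNX) (opNorm_nonneg _ _ _))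

/-- The composite `T_{n−1} ∘ ⋯ ∘ T₁ ∘ T₀` of the first `n` maps of a sequence (`T₀` applied first): the operator products
`K_{ω₁}G_k(□_{ω₁},Ã_{ω₁})h_{ω₁} ⋯ K_{ω_n}G_k(□_{ω_n},Ã_{ω_n})h_{ω_n}` of (2.18)/(2.20)/(2.21), read from the right.
[cite: Balaban1983RegularityDecay, (2.21) pp.578–579] -/
def compChain (T : ℕ → X → X) : ℕ → X → X
  | 0 => id
  | n + 1 => T n ∘ compChain T n

/-- The empty product of operators is the identity. [cite: Balaban1983RegularityDecay, (2.21) pp.578–579] -/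
@[simp] lemma compChain_zero (T : ℕ → X → X) : compChain T 0 = id := rfl

/-- One more factor on the left. [cite: Balaban1983RegularityDecay, (2.21) pp.578–579] -/
@[simp] lemma compChain_succ (T : ℕ → X → X) (n : ℕ) : compChain T (n + 1) = T n ∘ compChain T n := rfl

/-- THE CHAIN OF (2.21): if `T_i` is bounded by `C_i ≥ 0` from the gauge `N_i` to the gauge `N_{i+1}` (`i < n`), the product
`T_{n−1} ⋯ T₀` is bounded by `∏_{i<n} C_i` from `N₀` to `N_n` — print bounds `‖(K_{ω₁}G h_{ω₁} ⋯ K_{ω_n}G h_{ω_n}) f‖_∞` by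
*"`‖K_{ω₁}G_k(□_{ω₁},Ã_{ω₁})h_{ω₁}‖_{∞,p₁} ∏_{i=2}^{n₀} ‖K_{ω_i}G_k(□_{ω_i},Ã_{ω_i})h_{ω_i}‖_{p₁/(i−1), p₁/i} ·
∏_{i=n₀+1}^{n} ‖K_{ω_i}G_k(□_{ω_i},Ã_{ω_i})h_{ω_i}‖_{2,2} ‖f‖₂`"* (gauges `‖·‖₂ = … = ‖·‖₂, ‖·‖_{p₁/(n₀−1)}, …, ‖·‖_{p₁},
‖·‖_∞` read from the right). [cite: Balaban1983RegularityDecay, (2.21) pp.578–579] -/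
lemma isOpBound_compChain (N : ℕ → X → ℝ) (T : ℕ → X → X) (C : ℕ → ℝ) (n : ℕ) (hC : ∀ i < n, 0 ≤ C i)
    (h : ∀ i < n, IsOpBound (N i) (N (i + 1)) (T i) (C i)) :
    IsOpBound (N 0) (N n) (compChain T n) (∏ i ∈ Finset.range n, C i) := by
  induction n with
  | zero => simpa using isOpBound_id (N 0)
  | succ n ih =>
    have ih' := ih (fun i hi => hC i (Nat.lt_succ_of_lt hi)) (fun i hi => h i (Nat.lt_succ_of_lt hi))
    rw [Finset.prod_range_succ, mul_comm (∏ i ∈ Finset.range n, C i) (C n), compChain_succ]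
    exact (h n n.lt_succ_self).comp ih' (hC n n.lt_succ_self)

/-- (2.21) with the operator NORMS as the constants: `N_n ((T_{n−1} ⋯ T₀) f) ≤ (∏_{i<n} ‖T_i‖_{N_{i+1},N_i}) · N₀ f`, each
factor bounded and each source gauge nonnegative. [cite: Balaban1983RegularityDecay, (2.21) pp.578–579] -/
lemma apply_compChain_le_prod_opNorm_mul (N : ℕ → X → ℝ) (T : ℕ → X → X) (n : ℕ)
    (hN : ∀ i < n, ∀ f, 0 ≤ N i f) (hex : ∀ i < n, ∃ C, 0 ≤ C ∧ IsOpBound (N i) (N (i + 1)) (T i) C) (f : X) :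
    N n (compChain T n f) ≤ (∏ i ∈ Finset.range n, opNorm (N i) (N (i + 1)) (T i)) * N 0 f :=
  isOpBound_compChain N T (fun i => opNorm (N i) (N (i + 1)) (T i)) n (fun _ _ => opNorm_nonneg _ _ _)
    (fun i hi => isOpBound_opNorm (hex i hi) (hN i hi)) f

end Operator

section LatticeOperator

variable {ι κ : Type*} {E F : Type*} [SeminormedAddCommGroup E] [SeminormedAddCommGroup F]

/-- `‖T‖_{q,p}` of B4 p. 579 ON THE LATTICE NORMS of this module: `T` maps lattice functions on the region `S` (gauge
`‖·‖_p = lsNorm w s S`, `s = 1/p`) to lattice functions on the region `S'` (gauge `‖·‖_q = lsNorm w t S'`, `t = 1/q`), with the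
volume weight `w = η^d`; `s = 0` / `t = 0` are the sup norms, `s = t = 1/2` the `L² → L²` norm of Lemma 2.1 / (2.21).
[cite: Balaban1983RegularityDecay, (2.21) pp.578–579] -/
def opNormQP (w t s : ℝ) (S' : Finset κ) (S : Finset ι) (T : (ι → E) → κ → F) : ℝ :=
  opNorm (lsNorm w s S) (lsNorm w t S') T

/-- `‖T‖_{q,p} ≥ 0`. [cite: Balaban1983RegularityDecay, (2.21) pp.578–579] -/
lemma opNormQP_nonneg (w t s : ℝ) (S' : Finset κ) (S : Finset ι) (T : (ι → E) → κ → F) :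
    0 ≤ opNormQP w t s S' S T := opNorm_nonneg _ _ _

/-- `‖T‖_{q,p} ≤ C` from a bound `‖T f‖_q ≤ C‖f‖_p` for all `f` (`C ≥ 0`) — the reading of (2.17) as
`‖G_k(□,Ã)‖_{q,p}, ‖D^η_{Ã,μ}G_k(□,Ã)‖_{q,p}, ‖G_k(□,Ã)D^{η*}_{Ã,μ}‖_{q,p} ≤ c₂` on the printed parallelogram of exponents.
[cite: Balaban1983RegularityDecay, (2.21) pp.578–579] -/
lemma opNormQP_le_of_bound {w t s : ℝ} {S' : Finset κ} {S : Finset ι} {T : (ι → E) → κ → F} {C : ℝ} (hC : 0 ≤ C)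
    (h : ∀ f, lsNorm w t S' (T f) ≤ C * lsNorm w s S f) : opNormQP w t s S' S T ≤ C :=
  opNorm_le_of_bound hC h

/-- `‖T f‖_q ≤ ‖T‖_{q,p} ‖f‖_p` (nonnegative weight; some bound exists). [cite: Balaban1983RegularityDecay, (2.21) pp.578–579] -/
lemma lsNorm_apply_le_opNormQP_mul {w t s : ℝ} (hw : 0 ≤ w) {S' : Finset κ} {S : Finset ι} {T : (ι → E) → κ → F}
    (hex : ∃ C, 0 ≤ C ∧ ∀ f, lsNorm w t S' (T f) ≤ C * lsNorm w s S f) (f : ι → E) :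
    lsNorm w t S' (T f) ≤ opNormQP w t s S' S T * lsNorm w s S f :=
  le_opNorm_mul hex (lsNorm_nonneg hw s S) f

/-- The identity of lattice functions on a region `S` is bounded from `‖·‖_∞` (`s = 0`) to `‖·‖₂` (`s = 1/2`) by
`(η^d |S|)^{1/2}`: `‖id‖_{2,∞} ≤ √(w |S|)` — the volume factor of the silent step of (2.21). [cite: Balaban1983RegularityDecay, (2.21) pp.578–579] -/
lemma opNormQP_id_two_inf_le {w : ℝ} (hw : 0 ≤ w) (S : Finset ι) :
    opNormQP w (1 / 2) 0 S S (id : (ι → E) → ι → E) ≤ Real.sqrt (w * S.card) :=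
  opNormQP_le_of_bound (Real.sqrt_nonneg _) fun f => by
    simpa only [lsNorm_half, lsNorm_zero, id] using l2Norm_le_sqrt_card_mul_supNorm hw S f

end LatticeOperator

end

end LatticeNorms

end Literature.MathematicalPhysics.QuantumFieldTheory.Balaban1983to89
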